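import Literature.RepresentationTheory.GeneralLinear.WreathOrbitSums
import Literature.Computability.Complexity.DiscreteTomography
import HarnessLib

/-!
# Fischer–Ikenmeyer 2020, Thm. 4 in positivity form: cone pyramids give highest-weight vectors of
# `Λⁿ Λ³ V` / `Λⁿ Sym³ V`, and nonzero highest-weight vectors give cone point sets

N. Fischer, C. Ikenmeyer, *The computational complexity of plethysm coefficients*, Comput.
Complexity 29 (2020) 8, §5, Def. 1 and Thm. 4: for `λ ⊢ 3n`,
`a̲_λ(n,3) ≤ a_λ(n,3) ≤ ā_λ(n,3)` and `b̲_λ(n,3) ≤ b_λ(n,3) ≤ b̄_λ(n,3)`, where `a̲`/`ā` count the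
pyramids / point sets in the OPEN cone `C = {x > y > z}` with sum-marginal `λᵀ`, `b̲`/`b̄` those in the
CLOSED cone `C̄ = {x ≥ y ≥ z}` with sum-marginal `λ`, `a_λ(n,3)` is the multiplicity of `λᵀ` in
`Λⁿ Λ³ V` (Fact 1) and `b_λ(n,3)` that of `λ` in `Λⁿ Sym³ V`. Printed proof: the wedge monomials
`w_P = ⋀_{(x,y,z) ∈ P} X_x ∧ X_y ∧ X_z` (resp. `v_P = ⋀ X_x X_y X_z`) of the point sets `P` with
sum-marginal `κ` form a basis of the weight-`κ` space (upper bounds), and for a pyramid `P` the vector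
is annihilated by all raising operators (lower bounds).

This file proves the POSITIVITY content of Thm. 4, which is what the NP-hardness reduction
(FI Lemma 4) transports, in the word model of `WreathHighestWeight.lean`/`WreathOrbitSums.lean`
(`V^{⊗3n}` as functions on words with `n` blocks of `3` letters; `Λⁿ Λ³ V` = the `s`-isotypic part,
`s = restrSign n 3`; `Λⁿ Sym³ V` = the `σₒ`-isotypic part, `σₒ = outerSign`):

* **lower bounds** (`exists_mem_wreathHW_of_isPyramid_open`, `…_closed`): a pyramid `P` in `C`
  (resp. `C̄`) with `n` points and coordinates `< N` yields a NONZERO vector of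
  `wreathHW k N s (S(P))` (resp. `wreathHW k N σₒ (S(P))`), namely the signed orbit sum of the word
  listing the points of `P` block by block — FI's `w_P` (resp. `v_P`); the highest-weight property is
  the criterion of `WreathOrbitSums.lean`, whose combinatorial hypothesis ("a smaller good word equals
  the word of `P`") is verified here from the pyramid property by the printed argument (a surviving
  term moves points of `P` towards the origin injectively inside `P`, hence not at all);
* **upper bounds** (`exists_pointSet_of_wreathHW_ne_bot_open`, `…_closed`): a nonzero vector of
  `wreathHW k N s μ` (resp. `σₒ`) has in its support a word whose blocks, sorted, are `n` DISTINCT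
  points of `C` (resp. `C̄`) with sum-marginal `μ` (weight vectors are supported on words of content
  `μ`; a repeated letter in a block, resp. two blocks with the same letters, give an odd element of
  the stabiliser, which is excluded by the alternating property).

Conventions: `Literature.Computability.Complexity.Tomography` (`Point = ℕ × ℕ × ℕ`, `IsInOpenCone`,
`IsInClosedCone`, `Below`, `IsPyramid`, `sumMarginal`), the vocabulary of the languages
`PROMISE(SKEW)SYMTHREEDXRAY` of `DiscreteTomography.lean`. Characteristic zero throughout.

## References

* [FischerIkenmeyer2020] §5, Def. 1, Thm. 4 (and its proof), Fact 1.
-/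

noncomputable section

open scoped BigOperators

namespace Literature.RepresentationTheory.GeneralLinear

open Literature.NumberTheory.DiophantineGeometry Literature.Computability.AlgebraicComplexity
open Literature.Computability.Complexity.Tomography

/-! ### Sorting triples of naturals -/

section Triples

/-- The largest entry of a triple. [folklore] -/
def hi3 (t : Fin 3 → ℕ) : ℕ := max (t 0) (max (t 1) (t 2))

/-- The smallest entry of a triple. [folklore] -/
def lo3 (t : Fin 3 → ℕ) : ℕ := min (t 0) (min (t 1) (t 2))

/-- The median entry of a triple (a monotone `max`/`min` formula). [folklore] -/
def mid3 (t : Fin 3 → ℕ) : ℕ := max (min (t 0) (t 1)) (min (max (t 0) (t 1)) (t 2))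

/-- The entries of a triple sorted in weakly decreasing order, as a point `(x ≥ y ≥ z)` of the closed
cone. [cite: FischerIkenmeyer2020, §5 (proof of Thm. 4: monomials of `Sym³ V` ↔ points of `C̄`)] -/
def sortPt (t : Fin 3 → ℕ) : Point := (hi3 t, mid3 t, lo3 t)

/-- `lo ≤ mid ≤ hi`. [folklore] -/
theorem lo3_le_mid3_le_hi3 (t : Fin 3 → ℕ) : lo3 t ≤ mid3 t ∧ mid3 t ≤ hi3 t := by
  simp only [lo3, mid3, hi3]; omega

/-- The sorted triple lies in the closed cone. [folklore] -/
theorem isInClosedCone_sortPt (t : Fin 3 → ℕ) : IsInClosedCone (sortPt t) :=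
  ⟨(lo3_le_mid3_le_hi3 t).2, (lo3_le_mid3_le_hi3 t).1⟩

/-- `hi + mid + lo = t 0 + t 1 + t 2`. [folklore] -/
theorem hi3_add_mid3_add_lo3 (t : Fin 3 → ℕ) : hi3 t + mid3 t + lo3 t = t 0 + t 1 + t 2 := by
  simp only [lo3, mid3, hi3]; omega

/-- The coordinate sum of the sorted triple is the sum of the entries. [folklore] -/
theorem coordSum_sortPt (t : Fin 3 → ℕ) : coordSum (sortPt t) = t 0 + t 1 + t 2 :=
  hi3_add_mid3_add_lo3 t

/-- The three indices of `Fin 3`. [folklore] -/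
theorem fin3_cases (q : Fin 3) : q = 0 ∨ q = 1 ∨ q = 2 := by
  revert q; decide

/-- Every entry is at most `hi`. [folklore] -/
theorem le_hi3 (t : Fin 3 → ℕ) (p : Fin 3) : t p ≤ hi3 t := by
  rcases fin3_cases p with rfl | rfl | rfl <;> simp only [hi3] <;> omega

/-- Every entry is at least `lo`. [folklore] -/
theorem lo3_le (t : Fin 3 → ℕ) (p : Fin 3) : lo3 t ≤ t p := by
  rcases fin3_cases p with rfl | rfl | rfl <;> simp only [lo3] <;> omega

/-- `hi t ≤ a` iff all entries are `≤ a`. [folklore] -/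
theorem hi3_le_iff (t : Fin 3 → ℕ) (a : ℕ) : hi3 t ≤ a ↔ ∀ p, t p ≤ a := by
  constructor
  · intro h p; exact (le_hi3 t p).trans h
  · intro h; have h0 := h 0; have h1 := h 1; have h2 := h 2; simp only [hi3]; omega

/-- `a ≤ lo t` iff `a ≤` all entries. [folklore] -/
theorem le_lo3_iff (t : Fin 3 → ℕ) (a : ℕ) : a ≤ lo3 t ↔ ∀ p, a ≤ t p := by
  constructor
  · intro h p; exact h.trans (lo3_le t p)
  · intro h; have h0 := h 0; have h1 := h 1; have h2 := h 2; simp only [lo3]; omega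

/-- `hi` is invariant under rearrangement. [folklore] -/
theorem hi3_comp_perm (t : Fin 3 → ℕ) (σ : Equiv.Perm (Fin 3)) : hi3 (t ∘ ⇑σ) = hi3 t := by
  apply le_antisymm
  · exact (hi3_le_iff _ _).2 fun p => le_hi3 t (σ p)
  · exact (hi3_le_iff _ _).2 fun p => by
      have := le_hi3 (t ∘ ⇑σ) (σ.symm p); simpa using this

/-- `lo` is invariant under rearrangement. [folklore] -/
theorem lo3_comp_perm (t : Fin 3 → ℕ) (σ : Equiv.Perm (Fin 3)) : lo3 (t ∘ ⇑σ) = lo3 t := by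
  apply le_antisymm
  · exact (le_lo3_iff _ _).2 fun p => by
      have := lo3_le (t ∘ ⇑σ) (σ.symm p); simpa using this
  · exact (le_lo3_iff _ _).2 fun p => lo3_le t (σ p)

/-- The sum of the entries is invariant under rearrangement. [folklore] -/
theorem sum3_comp_perm (t : Fin 3 → ℕ) (σ : Equiv.Perm (Fin 3)) :
    (t ∘ ⇑σ) 0 + (t ∘ ⇑σ) 1 + (t ∘ ⇑σ) 2 = t 0 + t 1 + t 2 := by
  have h := Equiv.sum_comp σ t
  simpa [Fin.sum_univ_three] using h

/-- `mid` is invariant under rearrangement. [folklore] -/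
theorem mid3_comp_perm (t : Fin 3 → ℕ) (σ : Equiv.Perm (Fin 3)) : mid3 (t ∘ ⇑σ) = mid3 t := by
  have h1 := hi3_add_mid3_add_lo3 (t ∘ ⇑σ)
  have h2 := hi3_add_mid3_add_lo3 t
  have h3 := sum3_comp_perm t σ
  have h4 := hi3_comp_perm t σ
  have h5 := lo3_comp_perm t σ
  omega

/-- The sorted point is invariant under rearrangement of the triple. [folklore] -/
theorem sortPt_comp_perm (t : Fin 3 → ℕ) (σ : Equiv.Perm (Fin 3)) : sortPt (t ∘ ⇑σ) = sortPt t := by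
  rw [sortPt, sortPt, hi3_comp_perm, mid3_comp_perm, lo3_comp_perm]

/-- A weakly decreasing triple is already sorted. [folklore] -/
theorem sortPt_of_antitone {t : Fin 3 → ℕ} (ht : Antitone t) : sortPt t = (t 0, t 1, t 2) := by
  have h01 : t 1 ≤ t 0 := ht (by decide)
  have h12 : t 2 ≤ t 1 := ht (by decide)
  simp only [sortPt, hi3, mid3, lo3, Prod.mk.injEq]
  omega

/-- Sorting is monotone for the coordinatewise orders. [folklore] -/
theorem below_sortPt_of_le {t t' : Fin 3 → ℕ} (h : ∀ p, t p ≤ t' p) : Below (sortPt t) (sortPt t') := by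
  have h0 := h 0; have h1 := h 1; have h2 := h 2
  refine ⟨?_, ?_, ?_⟩ <;> simp only [sortPt, hi3, mid3, lo3] <;> omega

/-- A triple with pairwise distinct entries sorts into the OPEN cone. [folklore] -/
theorem isInOpenCone_sortPt {t : Fin 3 → ℕ} (ht : Function.Injective t) : IsInOpenCone (sortPt t) := by
  have h01 : t 0 ≠ t 1 := fun h => by have := ht h; exact absurd this (by decide)
  have h12 : t 1 ≠ t 2 := fun h => by have := ht h; exact absurd this (by decide)
  have h02 : t 0 ≠ t 2 := fun h => by have := ht h; exact absurd this (by decide)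
  refine ⟨?_, ?_⟩ <;> simp only [sortPt, hi3, mid3, lo3] <;> omega

/-- **A sorting permutation**: some rearrangement of `t` is `(hi, mid, lo)`. [folklore] -/
theorem exists_perm_sorted (t : Fin 3 → ℕ) :
    ∃ σ : Equiv.Perm (Fin 3), t (σ 0) = hi3 t ∧ t (σ 1) = mid3 t ∧ t (σ 2) = lo3 t := by
  rcases le_total (t 0) (t 1) with h01 | h01 <;> rcases le_total (t 1) (t 2) with h12 | h12 <;>
    rcases le_total (t 0) (t 2) with h02 | h02
  all_goals first
    | exact ⟨1, by simp only [hi3, mid3, lo3, Equiv.Perm.coe_one, id_eq]; omega⟩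
    | exact ⟨Equiv.swap 0 1, by simp [hi3, mid3, lo3, Equiv.swap_apply_of_ne_of_ne]; omega⟩
    | exact ⟨Equiv.swap 1 2, by simp [hi3, mid3, lo3, Equiv.swap_apply_of_ne_of_ne]; omega⟩
    | exact ⟨Equiv.swap 0 2, by simp [hi3, mid3, lo3, Equiv.swap_apply_of_ne_of_ne]; omega⟩
    | exact ⟨Equiv.swap 0 1 * Equiv.swap 1 2,
        by simp [hi3, mid3, lo3, Equiv.Perm.mul_apply, Equiv.swap_apply_of_ne_of_ne]; omega⟩
    | exact ⟨Equiv.swap 1 2 * Equiv.swap 0 1,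
        by simp [hi3, mid3, lo3, Equiv.Perm.mul_apply, Equiv.swap_apply_of_ne_of_ne]; omega⟩

/-- The sorting permutation in function form: `t ∘ σ = ![hi, mid, lo]`. [folklore] -/
theorem exists_perm_comp_eq_sorted (t : Fin 3 → ℕ) :
    ∃ σ : Equiv.Perm (Fin 3), ∀ p, t (σ p) = ![hi3 t, mid3 t, lo3 t] p := by
  obtain ⟨σ, h0, h1, h2⟩ := exists_perm_sorted t
  refine ⟨σ, fun p => ?_⟩
  fin_cases p
  · simpa using h0
  · simpa using h1
  · simpa using h2

/-- **Triples with the same sorted point are rearrangements of each other.** [folklore] -/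
theorem exists_perm_of_sortPt_eq {t t' : Fin 3 → ℕ} (h : sortPt t = sortPt t') :
    ∃ σ : Equiv.Perm (Fin 3), ∀ p, t' p = t (σ p) := by
  obtain ⟨σ, hσ⟩ := exists_perm_comp_eq_sorted t
  obtain ⟨σ', hσ'⟩ := exists_perm_comp_eq_sorted t'
  have hh : hi3 t = hi3 t' ∧ mid3 t = mid3 t' ∧ lo3 t = lo3 t' := by
    simpa [sortPt, Prod.mk.injEq] using h
  refine ⟨σ * σ'⁻¹, fun p => ?_⟩
  have e1 := hσ' (σ'⁻¹ p)
  have e2 := hσ (σ'⁻¹ p)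
  rw [perm_apply_inv_apply] at e1
  rw [Equiv.Perm.mul_apply, e2, e1, hh.1, hh.2.1, hh.2.2]

/-- Two weakly decreasing triples which are rearrangements of each other are equal. [folklore] -/
theorem eq_of_antitone_of_rearrangement {t t' : Fin 3 → ℕ} (ht : Antitone t) (ht' : Antitone t')
    (σ : Equiv.Perm (Fin 3)) (h : ∀ p, t' p = t (σ p)) : t' = t := by
  have hc : t' = t ∘ ⇑σ := funext h
  have hs : sortPt t' = sortPt t := by rw [hc, sortPt_comp_perm]
  rw [sortPt_of_antitone ht, sortPt_of_antitone ht'] at hs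
  simp only [Prod.mk.injEq] at hs
  funext p
  fin_cases p
  · exact hs.1
  · exact hs.2.1
  · exact hs.2.2

/-- The number of entries of a triple equal to `i`. [folklore] -/
def count3 (t : Fin 3 → ℕ) (i : ℕ) : ℕ :=
  (if t 0 = i then 1 else 0) + (if t 1 = i then 1 else 0) + (if t 2 = i then 1 else 0)

/-- `count3` as a filtered cardinality. [folklore] -/
theorem count3_eq_card (t : Fin 3 → ℕ) (i : ℕ) :
    count3 t i = (Finset.univ.filter fun p : Fin 3 => t p = i).card := by
  rw [Finset.card_filter, Fin.sum_univ_three, count3]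

/-- `count3` is invariant under rearrangement. [folklore] -/
theorem count3_comp_perm (t : Fin 3 → ℕ) (σ : Equiv.Perm (Fin 3)) (i : ℕ) :
    count3 (t ∘ ⇑σ) i = count3 t i := by
  rw [count3_eq_card, count3_eq_card, Finset.card_filter, Finset.card_filter]
  exact Equiv.sum_comp σ (fun p => if t p = i then 1 else 0)

/-- The multiplicity of the value `i` among the coordinates of a point. [folklore] -/
def mult3 (i : ℕ) (q : Point) : ℕ :=
  (if q.1 = i then 1 else 0) + (if q.2.1 = i then 1 else 0) + (if q.2.2 = i then 1 else 0)

/-- Sorting does not change the multiplicities of the values: `mult3 i (sortPt t) = count3 t i`. [folklore] -/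
theorem mult3_sortPt (t : Fin 3 → ℕ) (i : ℕ) : mult3 i (sortPt t) = count3 t i := by
  obtain ⟨σ, hσ⟩ := exists_perm_comp_eq_sorted t
  have hc : count3 (t ∘ ⇑σ) i = count3 t i := count3_comp_perm t σ i
  rw [← hc, count3]
  simp only [Function.comp_apply, hσ, sortPt, mult3]
  rfl

end Triples

/-! ### Words with blocks of three letters: block triples, block points, odd stabilisers -/

section Blocks

variable {N n : ℕ}

/-- Block `r` of a word, as a triple of naturals. [folklore] -/
def blockTriple (u : Word N (n * 3)) (r : Fin n) : Fin 3 → ℕ :=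
  fun p => (u (finProdFinEquiv (r, p)) : ℕ)

/-- The point of the closed cone obtained by sorting block `r` of a word (FI: the monomial
`X_x X_y X_z`, `x ≥ y ≥ z`, read off a block of three tensor factors). [cite: FischerIkenmeyer2020, §5 (proof of Thm. 4)] -/
def blockPoint (u : Word N (n * 3)) (r : Fin n) : Point :=
  sortPt (blockTriple u r)

/-- Unfolding lemma for `blockTriple`. [folklore] -/
theorem blockTriple_apply (u : Word N (n * 3)) (r : Fin n) (p : Fin 3) :
    blockTriple u r p = (u (finProdFinEquiv (r, p)) : ℕ) :=
  rfl

/-- A word is determined by its block triples. [folklore] -/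
theorem eq_of_blockTriple_eq {u w : Word N (n * 3)} (h : ∀ r, blockTriple u r = blockTriple w r) :
    u = w := by
  funext q
  obtain ⟨⟨r, p⟩, rfl⟩ := finProdFinEquiv.surjective q
  exact Fin.ext (congrFun (h r) p)

/-- **Odd stabiliser, first kind**: if block `r` of `u` carries the same letter at two places, the
transposition of these places lies in `S_n ≀ S_3`, fixes `u`, and has sign `-1` (so it is odd for
`s`: "a monomial `X_x ∧ X_y ∧ X_z` with a repeated index vanishes"). [cite: FischerIkenmeyer2020, §5 (proof of Thm. 4)] -/
theorem exists_odd_restrSign_of_eq (u : Word N (n * 3)) {r : Fin n} {p p' : Fin 3} (hpp' : p ≠ p')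
    (h : u (finProdFinEquiv (r, p)) = u (finProdFinEquiv (r, p'))) :
    ∃ τ₀ : ↥(blockPerms n 3), u ∘ ⇑(τ₀ : Equiv.Perm (Fin (n * 3))) = u ∧ restrSign n 3 τ₀ = -1 := by
  have hne : finProdFinEquiv (r, p) ≠ finProdFinEquiv (r, p') := fun e => by
    have := finProdFinEquiv.injective e
    simp only [Prod.mk.injEq, true_and] at this
    exact hpp' this
  refine ⟨⟨Equiv.swap (finProdFinEquiv (r, p)) (finProdFinEquiv (r, p')),
    swap_mem_blockPerms (by simp)⟩, ?_, ?_⟩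
  · funext q
    exact Equiv.apply_swap_eq_self h q
  · rw [restrSign_apply]
    exact Equiv.Perm.sign_swap hne

/-- The permutations inside the blocks used to exchange two blocks `r₁ ≠ r₂` whose letters match
along `σ`: `σ` on block `r₁`, `σ⁻¹` on block `r₂`, identity elsewhere. [folklore] -/
def matchInner (r₁ r₂ : Fin n) (σ : Equiv.Perm (Fin 3)) (r : Fin n) : Equiv.Perm (Fin 3) :=
  if r = r₁ then σ else if r = r₂ then σ⁻¹ else 1

/-- **Odd stabiliser, second kind**: if blocks `r₁ ≠ r₂` of `u` carry the same letters, matched by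
`σ` (`u(r₁, p) = u(r₂, σ p)`), then the element of `S_n ≀ S_3` exchanging the two blocks along the
matching fixes `u`, permutes the blocks by the transposition `(r₁ r₂)` (so it is odd for `σₒ`) and is
a product of three disjoint transpositions (so it is odd for `s`). FI: two equal factors of a wedge
power `⋀ⁿ`. [cite: FischerIkenmeyer2020, §5 (proof of Thm. 4)] -/
theorem exists_odd_of_blocks_match (u : Word N (n * 3)) {r₁ r₂ : Fin n} (hr : r₁ ≠ r₂)
    (σ : Equiv.Perm (Fin 3))
    (h : ∀ p, u (finProdFinEquiv (r₁, p)) = u (finProdFinEquiv (r₂, σ p))) :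
    ∃ τ₀ : ↥(blockPerms n 3), u ∘ ⇑(τ₀ : Equiv.Perm (Fin (n * 3))) = u ∧
      outerSign τ₀ = -1 ∧ restrSign n 3 τ₀ = -1 := by
  classical
  -- the permutation of `Fin n × Fin 3`: blocks swapped, letters matched
  set A : Equiv.Perm (Fin n × Fin 3) := Equiv.prodCongrLeft fun _ : Fin 3 => Equiv.swap r₁ r₂ with hA
  set B : Equiv.Perm (Fin n × Fin 3) := Equiv.prodCongrRight (matchInner r₁ r₂ σ) with hB
  set ψ : Equiv.Perm (Fin n × Fin 3) := A * B with hψ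
  have hψ_apply : ∀ r p, ψ (r, p) = (Equiv.swap r₁ r₂ r, matchInner r₁ r₂ σ r p) := fun r p => by
    rw [hψ, Equiv.Perm.mul_apply, hB, Equiv.prodCongrRight_apply, hA, Equiv.prodCongrLeft_apply]
  set τ : Equiv.Perm (Fin (n * 3)) := finProdFinEquiv.permCongr ψ with hτ
  have hτ_apply : ∀ r p, τ (finProdFinEquiv (r, p)) =
      finProdFinEquiv (Equiv.swap r₁ r₂ r, matchInner r₁ r₂ σ r p) := fun r p => by
    rw [hτ, Equiv.permCongr_apply, Equiv.symm_apply_apply, hψ_apply]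
  have hmem : τ ∈ blockPerms n 3 := by
    intro q q'
    obtain ⟨⟨r, p⟩, rfl⟩ := finProdFinEquiv.surjective q
    obtain ⟨⟨r', p'⟩, rfl⟩ := finProdFinEquiv.surjective q'
    rw [hτ_apply, hτ_apply]
    simp only [blockIdx_finProdFinEquiv]
    exact (Equiv.swap r₁ r₂).injective.eq_iff
  refine ⟨⟨τ, hmem⟩, ?_, ?_, ?_⟩
  · -- `u ∘ τ = u`
    funext q
    obtain ⟨⟨r, p⟩, rfl⟩ := finProdFinEquiv.surjective q
    rw [Function.comp_apply]
    change u (τ (finProdFinEquiv (r, p))) = _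
    rw [hτ_apply]
    by_cases h1 : r = r₁
    · subst h1
      rw [Equiv.swap_apply_left, matchInner, if_pos rfl, ← h]
    · by_cases h2 : r = r₂
      · subst h2
        rw [Equiv.swap_apply_right, matchInner, if_neg h1, if_pos rfl, h (σ⁻¹ p),
          perm_apply_inv_apply]
      · rw [Equiv.swap_apply_of_ne_of_ne h1 h2, matchInner, if_neg h1, if_neg h2, Equiv.Perm.coe_one,
          id_eq]
  · -- the induced block permutation is the transposition `(r₁ r₂)`
    have hbm : blockMap (⟨τ, hmem⟩ : ↥(blockPerms n 3)) = Equiv.swap r₁ r₂ := by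
      refine Equiv.ext fun r => ?_
      rw [blockMap_apply]
      change blockIdx n 3 (τ (finProdFinEquiv (r, (0 : Fin 3)))) = _
      rw [hτ_apply, blockIdx_finProdFinEquiv]
    rw [outerSign_apply, hbm, Equiv.Perm.sign_swap hr]
  · -- the sign: `(-1)^3 · ∏ sign (matchInner r) = -1`
    rw [restrSign_apply]
    change Equiv.Perm.sign τ = -1
    rw [hτ, Equiv.Perm.sign_permCongr, hψ, map_mul, hA, Equiv.Perm.sign_prodCongrLeft, hB,
      Equiv.Perm.sign_prodCongrRight, Fin.prod_univ_three, Equiv.Perm.sign_swap hr]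
    have hprod : ∏ r, Equiv.Perm.sign (matchInner r₁ r₂ σ r) = 1 := by
      rw [← Finset.mul_prod_erase _ _ (Finset.mem_univ r₁),
        ← Finset.mul_prod_erase _ _ (Finset.mem_erase.mpr ⟨Ne.symm hr, Finset.mem_univ r₂⟩),
        Finset.prod_eq_one]
      · rw [matchInner, if_pos rfl, matchInner, if_neg (Ne.symm hr), if_pos rfl, map_inv, ← mul_assoc,
          mul_inv_cancel, one_mul]
      · intro r hr'
        obtain ⟨hr2, hr''⟩ := Finset.mem_erase.mp hr'
        obtain ⟨hr1, _⟩ := Finset.mem_erase.mp hr''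
        rw [matchInner, if_neg hr1, if_neg hr2, map_one]
    rw [hprod, mul_one]
    decide

/-- No element of the stabiliser of `u` in `S_n ≀ S_3` is `χ`-odd. [folklore] -/
def NoOdd (χ : ↥(blockPerms n 3) →* ℤˣ) (u : Word N (n * 3)) : Prop :=
  ∀ τ₀ : ↥(blockPerms n 3), u ∘ ⇑(τ₀ : Equiv.Perm (Fin (n * 3))) = u → χ τ₀ ≠ -1

/-- Under `NoOdd s`, every block of `u` has pairwise distinct letters. [cite: FischerIkenmeyer2020, §5 (proof of Thm. 4)] -/
theorem blockTriple_injective_of_noOdd_restrSign {u : Word N (n * 3)} (hu : NoOdd (restrSign n 3) u)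
    (r : Fin n) : Function.Injective (blockTriple u r) := by
  intro p p' hpp
  by_contra hne
  have h : u (finProdFinEquiv (r, p)) = u (finProdFinEquiv (r, p')) := Fin.ext hpp
  obtain ⟨τ₀, hfix, hodd⟩ := exists_odd_restrSign_of_eq u hne h
  exact hu τ₀ hfix hodd

/-- Under `NoOdd s` or `NoOdd σₒ`, distinct blocks of `u` sort to distinct points. [cite: FischerIkenmeyer2020, §5 (proof of Thm. 4)] -/
theorem blockPoint_injective_of_noOdd {χ : ↥(blockPerms n 3) →* ℤˣ}
    (hχ : χ = restrSign n 3 ∨ χ = outerSign) {u : Word N (n * 3)} (hu : NoOdd χ u) :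
    Function.Injective (blockPoint u) := by
  intro r₁ r₂ h12
  by_contra hr
  obtain ⟨σ, hσ⟩ := exists_perm_of_sortPt_eq h12
  -- `hσ : blockTriple u r₂ p = blockTriple u r₁ (σ p)`, i.e. the blocks match along `σ` from `r₂`
  have hmatch : ∀ p, u (finProdFinEquiv (r₂, p)) = u (finProdFinEquiv (r₁, σ p)) := fun p =>
    Fin.ext (hσ p)
  obtain ⟨τ₀, hfix, hout, hres⟩ := exists_odd_of_blocks_match u (Ne.symm hr) σ hmatch
  rcases hχ with rfl | rfl
  · exact hu τ₀ hfix hres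
  · exact hu τ₀ hfix hout

/-- A nonzero value of a `χ`-isotypic highest-weight vector sits at a word without odd stabiliser
elements. [cite: FischerIkenmeyer2020, §5 (proof of Thm. 4)] -/
theorem noOdd_of_apply_ne_zero {k : Type*} [Field k] [CharZero k] {χ : ↥(blockPerms n 3) →* ℤˣ}
    {μ : Weight (Fin N)} {x : Word N (n * 3) → k} (hx : x ∈ wreathHW k N χ μ) {u : Word N (n * 3)}
    (hu : x u ≠ 0) : NoOdd χ u :=
  (content_eq_and_no_odd_of_apply_ne_zero hx hu).2

/-- A word whose signed orbit sum is nonzero has no odd stabiliser elements. [cite: FischerIkenmeyer2020, §5 (proof of Thm. 4)] -/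
theorem noOdd_of_twistedOrbitSum_ne_zero {k : Type*} [Field k] [CharZero k]
    {χ : ↥(blockPerms n 3) →* ℤˣ} {u : Word N (n * 3)}
    (hu : twistedOrbitSum k χ (Pi.single u 1) ≠ 0) : NoOdd χ u :=
  fun _ hfix hodd => hu (twistedOrbitSum_single_eq_zero χ hfix hodd)

end Blocks

/-! ### The point set of a good word -/

section PointSetOfWord

variable {N n : ℕ}

/-- The set of block points of a word. [cite: FischerIkenmeyer2020, §5 (proof of Thm. 4)] -/
def pointSetOfWord (u : Word N (n * 3)) : Finset Point :=
  Finset.univ.image (blockPoint u)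

/-- If the block points are distinct, the point set of the word has `n` elements. [folklore] -/
theorem card_pointSetOfWord {u : Word N (n * 3)} (hu : Function.Injective (blockPoint u)) :
    (pointSetOfWord u).card = n := by
  rw [pointSetOfWord, Finset.card_image_of_injective _ hu, Finset.card_univ, Fintype.card_fin]

/-- Marginals of an injective image: `X_i` counts the indices `r` with `(f r).1 = i`. [folklore] -/
theorem xMarginal_image {f : Fin n → Point} (hf : Function.Injective f) (i : ℕ) :
    xMarginal (Finset.univ.image f) i = ∑ r : Fin n, if (f r).1 = i then 1 else 0 := by
  classical
  rw [xMarginal, Finset.filter_image, Finset.card_image_of_injective _ hf, Finset.card_filter]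

/-- `Y_i` of an injective image. [folklore] -/
theorem yMarginal_image {f : Fin n → Point} (hf : Function.Injective f) (i : ℕ) :
    yMarginal (Finset.univ.image f) i = ∑ r : Fin n, if (f r).2.1 = i then 1 else 0 := by
  classical
  rw [yMarginal, Finset.filter_image, Finset.card_image_of_injective _ hf, Finset.card_filter]

/-- `Z_i` of an injective image. [folklore] -/
theorem zMarginal_image {f : Fin n → Point} (hf : Function.Injective f) (i : ℕ) :
    zMarginal (Finset.univ.image f) i = ∑ r : Fin n, if (f r).2.2 = i then 1 else 0 := by
  classical
  rw [zMarginal, Finset.filter_image, Finset.card_image_of_injective _ hf, Finset.card_filter]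

/-- **Sum-marginal of an injective image**: `S_i = ∑_r mult3 i (f r)`. [cite: FischerIkenmeyer2020, §5 (eq. (7))] -/
theorem sumMarginal_image {f : Fin n → Point} (hf : Function.Injective f) (i : ℕ) :
    sumMarginal (Finset.univ.image f) i = ∑ r : Fin n, mult3 i (f r) := by
  rw [sumMarginal, xMarginal_image hf, yMarginal_image hf, zMarginal_image hf,
    ← Finset.sum_add_distrib, ← Finset.sum_add_distrib]
  rfl

/-- The content of a word with blocks of three, blockwise: `content_i(u) = ∑_r count3 (block r) i`.
[folklore] -/
theorem wordContent_eq_sum_count3 (u : Word N (n * 3)) (i : Fin N) :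
    wordContent u i = ∑ r : Fin n, count3 (blockTriple u r) (i : ℕ) := by
  rw [wordContent, Finset.card_filter]
  rw [← Equiv.sum_comp finProdFinEquiv (fun q => if u q = i then 1 else 0), Fintype.sum_prod_type]
  refine Finset.sum_congr rfl fun r _ => ?_
  rw [Fin.sum_univ_three, count3]
  simp only [blockTriple_apply, Fin.val_eq_val]

/-- **The point set of a good word has sum-marginal the content of the word** (letters `< N`).
[cite: FischerIkenmeyer2020, §5 (proof of Thm. 4: "`X_x X_y X_z` is of weight `κ` iff `(x,y,z)` has sum-marginal `κ`")] -/
theorem sumMarginal_pointSetOfWord {u : Word N (n * 3)} (hu : Function.Injective (blockPoint u))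
    (i : Fin N) : sumMarginal (pointSetOfWord u) i = wordContent u i := by
  rw [pointSetOfWord, sumMarginal_image hu, wordContent_eq_sum_count3]
  refine Finset.sum_congr rfl fun r _ => ?_
  exact mult3_sortPt _ _

/-- Points of the point set of a word have coordinates `< N`. [folklore] -/
theorem lt_of_mem_pointSetOfWord {u : Word N (n * 3)} {q : Point} (hq : q ∈ pointSetOfWord u) :
    q.1 < N ∧ q.2.1 < N ∧ q.2.2 < N := by
  obtain ⟨r, _, rfl⟩ := Finset.mem_image.mp hq
  have hhi : hi3 (blockTriple u r) < N := by
    obtain ⟨σ, h0, -⟩ := exists_perm_sorted (blockTriple u r)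
    rw [← h0, blockTriple_apply]; exact Fin.is_lt _
  have h := lo3_le_mid3_le_hi3 (blockTriple u r)
  refine ⟨hhi, ?_, ?_⟩ <;> simp only [blockPoint, sortPt] <;> omega

/-- Beyond the alphabet the sum-marginal of the point set of a word vanishes. [folklore] -/
theorem sumMarginal_pointSetOfWord_eq_zero (u : Word N (n * 3)) {i : ℕ} (hi : N ≤ i) :
    sumMarginal (pointSetOfWord u) i = 0 := by
  have hx : xMarginal (pointSetOfWord u) i = 0 := Finset.card_eq_zero.2 (Finset.filter_eq_empty_iff.2
    fun q hq h => by have := (lt_of_mem_pointSetOfWord hq).1; omega)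
  have hy : yMarginal (pointSetOfWord u) i = 0 := Finset.card_eq_zero.2 (Finset.filter_eq_empty_iff.2
    fun q hq h => by have := (lt_of_mem_pointSetOfWord hq).2.1; omega)
  have hz : zMarginal (pointSetOfWord u) i = 0 := Finset.card_eq_zero.2 (Finset.filter_eq_empty_iff.2
    fun q hq h => by have := (lt_of_mem_pointSetOfWord hq).2.2; omega)
  simp [sumMarginal, hx, hy, hz]

/-- Points of the point set of any word lie in the closed cone. [folklore] -/
theorem isInClosedCone_of_mem_pointSetOfWord {u : Word N (n * 3)} {q : Point}
    (hq : q ∈ pointSetOfWord u) : IsInClosedCone q := by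
  obtain ⟨r, _, rfl⟩ := Finset.mem_image.mp hq
  exact isInClosedCone_sortPt _

/-- Under `NoOdd s` the points of the point set lie in the OPEN cone. [cite: FischerIkenmeyer2020, §5 (proof of Thm. 4)] -/
theorem isInOpenCone_of_mem_pointSetOfWord {u : Word N (n * 3)} (hu : NoOdd (restrSign n 3) u)
    {q : Point} (hq : q ∈ pointSetOfWord u) : IsInOpenCone q := by
  obtain ⟨r, _, rfl⟩ := Finset.mem_image.mp hq
  exact isInOpenCone_sortPt (blockTriple_injective_of_noOdd_restrSign hu r)

end PointSetOfWord

/-! ### Upper bounds: nonzero highest-weight vectors give point sets (FI Thm. 4, `a ≤ ā`, `b ≤ b̄`) -/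

section Upper

variable {k : Type*} [Field k] [CharZero k] {N n : ℕ}

/-- **Upper bound, both cones at once.** A nonzero vector of `wreathHW k N χ μ`, `χ ∈ {s, σₒ}`, yields
`n` distinct points of the closed cone with coordinates `< N` and sum-marginal `μ`; for `χ = s` they
lie in the open cone. [cite: FischerIkenmeyer2020, Thm. 4 (upper bounds)] -/
theorem exists_pointSet_of_wreathHW_ne_bot {χ : ↥(blockPerms n 3) →* ℤˣ}
    (hχ : χ = restrSign n 3 ∨ χ = outerSign) {μ : Weight (Fin N)} (h : wreathHW k N χ μ ≠ ⊥) :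
    ∃ u : Word N (n * 3), NoOdd χ u ∧ Function.Injective (blockPoint u) ∧
      (pointSetOfWord u).card = n ∧ (∀ i : Fin N, (sumMarginal (pointSetOfWord u) i : ℤ) = μ i) ∧
      ∀ i, N ≤ i → sumMarginal (pointSetOfWord u) i = 0 := by
  obtain ⟨x, hx, hx0⟩ := (Submodule.ne_bot_iff _).mp h
  obtain ⟨u, hu⟩ := Function.ne_iff.mp hx0
  have hno : NoOdd χ u := noOdd_of_apply_ne_zero hx hu
  have hinj : Function.Injective (blockPoint u) := blockPoint_injective_of_noOdd hχ hno
  refine ⟨u, hno, hinj, card_pointSetOfWord hinj, fun i => ?_, fun i hi => sumMarginal_pointSetOfWord_eq_zero u hi⟩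
  rw [sumMarginal_pointSetOfWord hinj]
  exact (content_eq_and_no_odd_of_apply_ne_zero hx hu).1 i

/-- **FI Thm. 4, `a_λ(n,3) ≤ ā_λ(n,3)` in positivity form (open cone).** If the `s`-isotypic
(`Λⁿ Λ³`) highest-weight space of weight `μ` of `(k^N)^{⊗3n}` is nonzero, there is a set of `n` points
of the open cone `C` with sum-marginal `μ` (inside the box `[0,N)³`). [cite: FischerIkenmeyer2020, Thm. 4] -/
theorem exists_pointSet_of_wreathHW_ne_bot_open {μ : Weight (Fin N)}
    (h : wreathHW k N (restrSign n 3) μ ≠ ⊥) :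
    ∃ Q : Finset Point, (∀ q ∈ Q, IsInOpenCone q) ∧ Q.card = n ∧ (∀ q ∈ Q, q.1 < N) ∧
      (∀ i : Fin N, (sumMarginal Q i : ℤ) = μ i) ∧ ∀ i, N ≤ i → sumMarginal Q i = 0 := by
  obtain ⟨u, hno, _, hcard, hS, hS0⟩ := exists_pointSet_of_wreathHW_ne_bot (Or.inl rfl) h
  exact ⟨pointSetOfWord u, fun q hq => isInOpenCone_of_mem_pointSetOfWord hno hq, hcard,
    fun q hq => (lt_of_mem_pointSetOfWord hq).1, hS, hS0⟩

/-- **FI Thm. 4, `b_λ(n,3) ≤ b̄_λ(n,3)` in positivity form (closed cone).** If the `σₒ`-isotypic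
(`Λⁿ Sym³`) highest-weight space of weight `μ` is nonzero, there is a set of `n` points of the closed
cone `C̄` with sum-marginal `μ`. [cite: FischerIkenmeyer2020, Thm. 4] -/
theorem exists_pointSet_of_wreathHW_ne_bot_closed {μ : Weight (Fin N)}
    (h : wreathHW k N (outerSign (n := n) (m := 3)) μ ≠ ⊥) :
    ∃ Q : Finset Point, (∀ q ∈ Q, IsInClosedCone q) ∧ Q.card = n ∧ (∀ q ∈ Q, q.1 < N) ∧
      (∀ i : Fin N, (sumMarginal Q i : ℤ) = μ i) ∧ ∀ i, N ≤ i → sumMarginal Q i = 0 := by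
  obtain ⟨u, _, _, hcard, hS, hS0⟩ := exists_pointSet_of_wreathHW_ne_bot (Or.inr rfl) h
  exact ⟨pointSetOfWord u, fun q hq => isInClosedCone_of_mem_pointSetOfWord hq, hcard,
    fun q hq => (lt_of_mem_pointSetOfWord hq).1, hS, hS0⟩

end Upper

/-! ### Lower bounds: the word of a pyramid gives a highest-weight vector (FI Thm. 4, `a̲ ≤ a`, `b̲ ≤ b`) -/

section Lower

variable {N n : ℕ}

/-- The word listing a family of letter triples block by block. [cite: FischerIkenmeyer2020, §5 (proof of Thm. 4: `v_P`, `w_P`)] -/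
def familyWord (pt : Fin n → Fin 3 → Fin N) : Word N (n * 3) :=
  fun q => pt (finProdFinEquiv.symm q).1 (finProdFinEquiv.symm q).2

/-- The blocks of `familyWord pt` are the `pt r`. [folklore] -/
theorem familyWord_apply (pt : Fin n → Fin 3 → Fin N) (r : Fin n) (p : Fin 3) :
    familyWord pt (finProdFinEquiv (r, p)) = pt r p := by
  simp [familyWord]

/-- The block triples of `familyWord pt`. [folklore] -/
theorem blockTriple_familyWord (pt : Fin n → Fin 3 → Fin N) (r : Fin n) :
    blockTriple (familyWord pt) r = fun p => (pt r p : ℕ) := by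
  funext p
  rw [blockTriple_apply, familyWord_apply]

/-- The block triples of `familyWord pt`, letterwise. [folklore] -/
theorem blockTriple_familyWord_apply (pt : Fin n → Fin 3 → Fin N) (r : Fin n) (p : Fin 3) :
    blockTriple (familyWord pt) r p = (pt r p : ℕ) := by
  rw [blockTriple_apply, familyWord_apply]

/-- **The combinatorial heart of the lower bound** ("pyramids have no holes"). Let `pt` be a family
of weakly decreasing letter triples (points of the closed cone, coordinates `< N`) with the pyramid
property: every weakly decreasing triple `t` satisfying `good t` and lying letterwise below some
`pt r` is itself some `pt r'`. Let `u ≤ familyWord pt` letterwise be a word whose sorted blocks are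
distinct and satisfy `good`. Then `u = familyWord pt`: block `r` of `u` sorts to a point `q_r ≤ pt r`
of the pyramid, `r ↦ q_r` is injective hence a bijection dominated by the identity, and comparing
coordinate sums forces `q_r = pt r` and then the block itself to be `pt r`. This is the printed
argument that a surviving summand of `E_{i,j} v_P` "arises from `P` by replacing some coordinate `j`
of some point by `i` … thereby that point is moved closer to the origin", impossible injectively
inside a pyramid. [cite: FischerIkenmeyer2020, §5 (proof of Thm. 4)] -/
theorem eq_familyWord_of_le (pt : Fin n → Fin 3 → Fin N) (good : (Fin 3 → ℕ) → Prop)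
    (hsorted : ∀ r, Antitone fun p => (pt r p : ℕ))
    (hpyr : ∀ r (t : Fin 3 → ℕ), Antitone t → good t → (∀ p, t p ≤ (pt r p : ℕ)) →
      ∃ r', (fun p => (pt r' p : ℕ)) = t)
    {u : Word N (n * 3)} (hle : ∀ q, u q ≤ familyWord pt q)
    (hinj : Function.Injective (blockPoint u))
    (hgood : ∀ r, good ![hi3 (blockTriple u r), mid3 (blockTriple u r), lo3 (blockTriple u r)]) :
    u = familyWord pt := by
  -- blockwise comparison
  have hle' : ∀ r p, blockTriple u r p ≤ blockTriple (familyWord pt) r p := fun r p => by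
    rw [blockTriple_apply, blockTriple_apply]
    exact hle _
  have hbw : ∀ r, blockPoint (familyWord pt) r = ((pt r 0 : ℕ), (pt r 1 : ℕ), (pt r 2 : ℕ)) :=
    fun r => by rw [blockPoint, blockTriple_familyWord, sortPt_of_antitone (hsorted r)]
  have hbel : ∀ r, hi3 (blockTriple u r) ≤ hi3 (blockTriple (familyWord pt) r) ∧
      mid3 (blockTriple u r) ≤ mid3 (blockTriple (familyWord pt) r) ∧
      lo3 (blockTriple u r) ≤ lo3 (blockTriple (familyWord pt) r) := fun r =>
    below_sortPt_of_le (hle' r)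
  have hsw : ∀ r, hi3 (blockTriple (familyWord pt) r) = pt r 0 ∧
      mid3 (blockTriple (familyWord pt) r) = pt r 1 ∧ lo3 (blockTriple (familyWord pt) r) = pt r 2 :=
    fun r => by
    have h := sortPt_of_antitone (t := blockTriple (familyWord pt) r)
      (by rw [blockTriple_familyWord]; exact hsorted r)
    simp only [sortPt, Prod.mk.injEq, blockTriple_familyWord_apply] at h
    exact h
  -- the sorted block `q_r` of `u` is a point of the pyramid: `q_r = pt (φ r)`
  have hex : ∀ r, ∃ r', blockPoint (familyWord pt) r' = blockPoint u r := by
    intro r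
    obtain ⟨h1, h2, h3⟩ := hbel r
    obtain ⟨e1, e2, e3⟩ := hsw r
    have hml := lo3_le_mid3_le_hi3 (blockTriple u r)
    obtain ⟨r', hr'⟩ := hpyr r ![hi3 (blockTriple u r), mid3 (blockTriple u r), lo3 (blockTriple u r)]
      (by
        intro a b hab
        rcases fin3_cases a with rfl | rfl | rfl <;> rcases fin3_cases b with rfl | rfl | rfl <;>
          simp at hab ⊢ <;> omega)
      (hgood r)
      (by intro p; rcases fin3_cases p with rfl | rfl | rfl <;> simp <;> omega)
    refine ⟨r', ?_⟩
    have h0 := congrFun hr' 0; have h1' := congrFun hr' 1; have h2' := congrFun hr' 2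
    simp at h0 h1' h2'
    rw [hbw r', blockPoint, sortPt, h0, h1', h2']
  choose φ hφ using hex
  have hφinj : Function.Injective φ := fun r₁ r₂ h12 => hinj (by rw [← hφ r₁, ← hφ r₂, h12])
  have hφbij : Function.Bijective φ := Finite.injective_iff_bijective.mp hφinj
  -- coordinate sums: termwise `≤`, equal in total, hence termwise equal
  have hcs : ∀ r, coordSum (blockPoint u r) =
      hi3 (blockTriple u r) + mid3 (blockTriple u r) + lo3 (blockTriple u r) := fun r => rfl
  have hcs' : ∀ r, coordSum (blockPoint (familyWord pt) r) = hi3 (blockTriple (familyWord pt) r) +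
      mid3 (blockTriple (familyWord pt) r) + lo3 (blockTriple (familyWord pt) r) := fun r => rfl
  have hcs_le : ∀ r, coordSum (blockPoint u r) ≤ coordSum (blockPoint (familyWord pt) r) := fun r => by
    obtain ⟨h1, h2, h3⟩ := hbel r
    rw [hcs, hcs']
    omega
  have hsum : ∑ r, coordSum (blockPoint u r) = ∑ r, coordSum (blockPoint (familyWord pt) r) := by
    calc ∑ r, coordSum (blockPoint u r) = ∑ r, coordSum (blockPoint (familyWord pt) (φ r)) := by
          simp_rw [hφ]
      _ = ∑ r, coordSum (blockPoint (familyWord pt) r) :=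
          Equiv.sum_comp (Equiv.ofBijective φ hφbij) (fun r => coordSum (blockPoint (familyWord pt) r))
  have hcs_eq : ∀ r, coordSum (blockPoint u r) = coordSum (blockPoint (familyWord pt) r) := fun r =>
    (Finset.sum_eq_sum_iff_of_le fun r _ => hcs_le r).mp hsum r (Finset.mem_univ r)
  -- hence the sorted blocks agree, and then the blocks themselves
  refine eq_of_blockTriple_eq fun r => ?_
  obtain ⟨h1, h2, h3⟩ := hbel r
  have he := hcs_eq r
  rw [hcs, hcs'] at he
  have hs := hi3_add_mid3_add_lo3 (blockTriple u r)
  have hs' := hi3_add_mid3_add_lo3 (blockTriple (familyWord pt) r)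
  have e0 := hle' r 0; have e1 := hle' r 1; have e2 := hle' r 2
  funext p
  rcases fin3_cases p with rfl | rfl | rfl <;> omega

variable (k : Type*) [Field k] [CharZero k]

/-- **Lower bound, abstract form.** For a family `pt` as in `eq_familyWord_of_le`, with `χ ∈ {s, σₒ}`
and `good` implied by `NoOdd χ`, the signed orbit sum `A_χ δ_{familyWord pt}` is a highest-weight
vector: it lies in `wreathHW k N χ (content)`. [cite: FischerIkenmeyer2020, Thm. 4 (lower bounds) and its proof] -/
theorem twistedOrbitSum_familyWord_mem_wreathHW {χ : ↥(blockPerms n 3) →* ℤˣ}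
    (hχ : χ = restrSign n 3 ∨ χ = outerSign) (pt : Fin n → Fin 3 → Fin N)
    (good : (Fin 3 → ℕ) → Prop) (hsorted : ∀ r, Antitone fun p => (pt r p : ℕ))
    (hpyr : ∀ r (t : Fin 3 → ℕ), Antitone t → good t → (∀ p, t p ≤ (pt r p : ℕ)) →
      ∃ r', (fun p => (pt r' p : ℕ)) = t)
    (hgood : ∀ u : Word N (n * 3), NoOdd χ u → ∀ r,
      good ![hi3 (blockTriple u r), mid3 (blockTriple u r), lo3 (blockTriple u r)]) :
    twistedOrbitSum k χ (Pi.single (familyWord pt) 1) ∈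
      wreathHW k N χ (fun i => (wordContent (familyWord pt) i : ℤ)) := by
  refine twistedOrbitSum_single_mem_wreathHW χ _ fun u hle hne => ?_
  have hno : NoOdd χ u := noOdd_of_twistedOrbitSum_ne_zero hne
  exact eq_familyWord_of_le pt good hsorted hpyr hle (blockPoint_injective_of_noOdd hχ hno) (hgood u hno)

/-- **Stabiliser of the word of an injective family of sorted triples**: an element of `S_n ≀ S_3`
fixing `familyWord pt` permutes the blocks trivially and rearranges each block into itself.
[cite: FischerIkenmeyer2020, §5 (proof of Thm. 4)] -/
theorem blockMap_eq_one_of_comp_eq (pt : Fin n → Fin 3 → Fin N)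
    (hsorted : ∀ r, Antitone fun p => (pt r p : ℕ)) (hinj : Function.Injective pt)
    (τ : ↥(blockPerms n 3))
    (hfix : familyWord pt ∘ ⇑(τ : Equiv.Perm (Fin (n * 3))) = familyWord pt) :
    blockMap τ = 1 ∧ ∀ r p, pt r (innerPerm τ r p) = pt r p := by
  have hblk : ∀ r p, pt (blockMap τ r) (innerPerm τ r p) = pt r p := fun r p => by
    have := congrFun hfix (finProdFinEquiv (r, p))
    rw [Function.comp_apply, apply_finProdFinEquiv_of_mem τ.2, familyWord_apply, familyWord_apply] at this
    exact this
  have hπ : ∀ r, blockMap τ r = r := fun r => by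
    have hrearr : (fun p => (pt r p : ℕ)) = fun p => (pt (blockMap τ r) p : ℕ) :=
      eq_of_antitone_of_rearrangement (hsorted (blockMap τ r)) (hsorted r) (innerPerm τ r)
        fun p => by simp only [hblk r p]
    have : pt r = pt (blockMap τ r) := by
      funext p; exact Fin.ext (congrFun hrearr p)
    exact (hinj this).symm
  refine ⟨Equiv.ext hπ, fun r p => ?_⟩
  have := hblk r p
  rwa [hπ r] at this

/-- **Nonvanishing, closed cone** (`χ = σₒ`): the stabiliser permutes the blocks trivially, so
`σₒ = 1` on it and `(A δ_w)(w) ≠ 0`. [cite: FischerIkenmeyer2020, §5 (proof of Thm. 4)] -/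
theorem twistedOrbitSum_familyWord_ne_zero_closed (pt : Fin n → Fin 3 → Fin N)
    (hsorted : ∀ r, Antitone fun p => (pt r p : ℕ)) (hinj : Function.Injective pt) :
    twistedOrbitSum k (outerSign (n := n) (m := 3)) (Pi.single (familyWord pt) 1) ≠ 0 := by
  refine twistedOrbitSum_single_ne_zero _ fun τ hfix => ?_
  rw [outerSign_apply, (blockMap_eq_one_of_comp_eq pt hsorted hinj τ hfix).1, map_one]

/-- **Nonvanishing, open cone** (`χ = s`, triples with distinct letters): the stabiliser is trivial.
[cite: FischerIkenmeyer2020, §5 (proof of Thm. 4)] -/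
theorem twistedOrbitSum_familyWord_ne_zero_open (pt : Fin n → Fin 3 → Fin N)
    (hsorted : ∀ r, Antitone fun p => (pt r p : ℕ)) (hinj : Function.Injective pt)
    (hstrict : ∀ r, Function.Injective (pt r)) :
    twistedOrbitSum k (restrSign n 3) (Pi.single (familyWord pt) 1) ≠ 0 := by
  refine twistedOrbitSum_single_ne_zero _ fun τ hfix => ?_
  obtain ⟨hbm, hin⟩ := blockMap_eq_one_of_comp_eq pt hsorted hinj τ hfix
  have hinner : ∀ r, innerPerm τ r = 1 := fun r => Equiv.ext fun p => hstrict r (hin r p)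
  have hτ1 : (τ : Equiv.Perm (Fin (n * 3))) = 1 := by
    rw [coe_eq_outer_mul_inner τ, hbm]
    refine Equiv.ext fun q => ?_
    obtain ⟨⟨r, p⟩, rfl⟩ := finProdFinEquiv.surjective q
    rw [Equiv.Perm.mul_apply, innerBlockPerm_apply, outerBlockPerm_apply, hinner r]
    rfl
  rw [restrSign_apply, hτ1, map_one]

/-! #### From finite point sets to families -/

/-- An enumeration of an `n`-element set of points. [folklore] -/
def enumPoints (P : Finset Point) (hcard : P.card = n) : Fin n ≃ ↥P :=
  (P.equivFin.trans (finCongr hcard)).symm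

/-- The letter triples of an enumerated point set with coordinates `< N` in the closed cone. [folklore] -/
def familyOfPointSet (P : Finset Point) (hcard : P.card = n) (hC : ∀ p ∈ P, IsInClosedCone p)
    (hN : ∀ p ∈ P, p.1 < N) (r : Fin n) : Fin 3 → Fin N :=
  let q : ↥P := enumPoints P hcard r
  ![⟨q.1.1, hN q.1 q.2⟩,
    ⟨q.1.2.1, lt_of_le_of_lt (hC q.1 q.2).1 (hN q.1 q.2)⟩,
    ⟨q.1.2.2, lt_of_le_of_lt ((hC q.1 q.2).2.trans (hC q.1 q.2).1) (hN q.1 q.2)⟩]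

variable {k}

/-- Values of `familyOfPointSet` as naturals. [folklore] -/
theorem familyOfPointSet_val (P : Finset Point) (hcard : P.card = n) (hC : ∀ p ∈ P, IsInClosedCone p)
    (hN : ∀ p ∈ P, p.1 < N) (r : Fin n) :
    (fun p => (familyOfPointSet P hcard hC hN r p : ℕ)) =
      ![(enumPoints P hcard r).1.1, (enumPoints P hcard r).1.2.1, (enumPoints P hcard r).1.2.2] := by
  funext p
  fin_cases p <;> rfl

/-- The triples of a point set in the closed cone are weakly decreasing. [folklore] -/
theorem antitone_familyOfPointSet (P : Finset Point) (hcard : P.card = n)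
    (hC : ∀ p ∈ P, IsInClosedCone p) (hN : ∀ p ∈ P, p.1 < N) (r : Fin n) :
    Antitone fun p => (familyOfPointSet P hcard hC hN r p : ℕ) := by
  rw [familyOfPointSet_val]
  have h := hC _ (enumPoints P hcard r).2
  intro a b hab
  fin_cases a <;> fin_cases b <;> simp [IsInClosedCone] at hab h ⊢ <;> omega

/-- Distinct points give distinct triples. [folklore] -/
theorem familyOfPointSet_injective (P : Finset Point) (hcard : P.card = n)
    (hC : ∀ p ∈ P, IsInClosedCone p) (hN : ∀ p ∈ P, p.1 < N) :
    Function.Injective (familyOfPointSet P hcard hC hN) := by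
  intro r₁ r₂ h
  have hv : (fun p => (familyOfPointSet P hcard hC hN r₁ p : ℕ)) =
      fun p => (familyOfPointSet P hcard hC hN r₂ p : ℕ) := by rw [h]
  rw [familyOfPointSet_val, familyOfPointSet_val] at hv
  have h0 := congrFun hv 0; have h1 := congrFun hv 1; have h2 := congrFun hv 2
  simp at h0 h1 h2
  apply (enumPoints P hcard).injective
  exact Subtype.ext (Prod.ext h0 (Prod.ext h1 h2))

/-- In the OPEN cone the triples have distinct letters. [folklore] -/
theorem familyOfPointSet_injective_of_open (P : Finset Point) (hcard : P.card = n)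
    (hO : ∀ p ∈ P, IsInOpenCone p) (hC : ∀ p ∈ P, IsInClosedCone p) (hN : ∀ p ∈ P, p.1 < N)
    (r : Fin n) : Function.Injective (familyOfPointSet P hcard hC hN r) := by
  have h := hO _ (enumPoints P hcard r).2
  have hv := familyOfPointSet_val P hcard hC hN r
  intro a b hab
  have hab' : (familyOfPointSet P hcard hC hN r a : ℕ) = familyOfPointSet P hcard hC hN r b :=
    congrArg Fin.val hab
  have ha := congrFun hv a; have hb := congrFun hv b
  rw [ha, hb] at hab'
  fin_cases a <;> fin_cases b <;> simp [IsInOpenCone] at hab' h ⊢ <;> omega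

/-- **The pyramid property in family form**: a weakly decreasing triple in `K`, letterwise below a
triple of the pyramid, is a triple of the pyramid. [cite: FischerIkenmeyer2020, §5 (pyramids)] -/
theorem exists_eq_of_isPyramid {K : Point → Prop} (P : Finset Point) (hP : IsPyramid K P)
    (hcard : P.card = n) (hC : ∀ p ∈ P, IsInClosedCone p) (hN : ∀ p ∈ P, p.1 < N) (r : Fin n)
    (t : Fin 3 → ℕ) (hK : K (t 0, t 1, t 2))
    (hle : ∀ p, t p ≤ (familyOfPointSet P hcard hC hN r p : ℕ)) :
    ∃ r', (fun p => (familyOfPointSet P hcard hC hN r' p : ℕ)) = t := by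
  have hv := familyOfPointSet_val P hcard hC hN r
  have h0 := hle 0; have h1 := hle 1; have h2 := hle 2
  rw [congrFun hv 0] at h0; rw [congrFun hv 1] at h1; rw [congrFun hv 2] at h2
  simp at h0 h1 h2
  have hmem : (t 0, t 1, t 2) ∈ P := hP.2 _ (enumPoints P hcard r).2 _ hK ⟨h0, h1, h2⟩
  refine ⟨(enumPoints P hcard).symm ⟨_, hmem⟩, ?_⟩
  rw [familyOfPointSet_val]
  simp only [Equiv.apply_symm_apply]
  funext p
  fin_cases p <;> rfl

/-- The image of the enumeration is the point set. [folklore] -/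
theorem image_enumPoints (P : Finset Point) (hcard : P.card = n) :
    Finset.univ.image (fun r => ((enumPoints P hcard r : ↥P) : Point)) = P := by
  ext q
  simp only [Finset.mem_image, Finset.mem_univ, true_and]
  constructor
  · rintro ⟨r, rfl⟩; exact (enumPoints P hcard r).2
  · intro hq; exact ⟨(enumPoints P hcard).symm ⟨q, hq⟩, by simp⟩

/-- **The content of the word of a point set is its sum-marginal.** [cite: FischerIkenmeyer2020, §5 (proof of Thm. 4: "`v_P` is a weight vector of weight `λ`")] -/
theorem wordContent_familyWord_familyOfPointSet (P : Finset Point) (hcard : P.card = n)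
    (hC : ∀ p ∈ P, IsInClosedCone p) (hN : ∀ p ∈ P, p.1 < N) (i : Fin N) :
    wordContent (familyWord (familyOfPointSet P hcard hC hN)) i = sumMarginal P i := by
  have hinj : Function.Injective fun r => ((enumPoints P hcard r : ↥P) : Point) :=
    fun r₁ r₂ h => (enumPoints P hcard).injective (Subtype.ext h)
  conv_rhs => rw [← image_enumPoints P hcard, sumMarginal_image hinj]
  rw [wordContent_eq_sum_count3]
  refine Finset.sum_congr rfl fun r _ => ?_
  rw [blockTriple_familyWord, familyOfPointSet_val, count3, mult3]
  rfl

/-- The weight `S(P)` restricted to `Fin N` equals the content weight of the word of `P`. [folklore] -/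
theorem weight_sumMarginal_eq (P : Finset Point) (hcard : P.card = n)
    (hC : ∀ p ∈ P, IsInClosedCone p) (hN : ∀ p ∈ P, p.1 < N) :
    (fun i : Fin N => (sumMarginal P i : ℤ)) =
      fun i => (wordContent (familyWord (familyOfPointSet P hcard hC hN)) i : ℤ) := by
  funext i
  rw [wordContent_familyWord_familyOfPointSet]

variable (k)

/-- **FI Thm. 4, `b̲_λ(n,3) ≤ b_λ(n,3)` in positivity form (closed cone).** A pyramid in the closed
cone `C̄` with `n` points, coordinates `< N`, gives a nonzero highest-weight vector of weight `S(P)` in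
the `σₒ`-isotypic (`Λⁿ Sym³`) part of `(k^N)^{⊗3n}`: FI's `v_P = ⋀_{(x,y,z) ∈ P} X_x X_y X_z`.
[cite: FischerIkenmeyer2020, Thm. 4 (lower bound) and its proof] -/
theorem exists_mem_wreathHW_of_isPyramid_closed (P : Finset Point)
    (hP : IsPyramid IsInClosedCone P) (hcard : P.card = n) (hN : ∀ p ∈ P, p.1 < N) :
    ∃ x ∈ wreathHW k N (outerSign (n := n) (m := 3)) (fun i => (sumMarginal P i : ℤ)), x ≠ 0 := by
  have hC : ∀ p ∈ P, IsInClosedCone p := hP.1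
  set pt := familyOfPointSet P hcard hC hN with hpt
  refine ⟨twistedOrbitSum k outerSign (Pi.single (familyWord pt) 1), ?_, ?_⟩
  · rw [weight_sumMarginal_eq P hcard hC hN]
    refine twistedOrbitSum_familyWord_mem_wreathHW k (Or.inr rfl) pt (fun _ => True)
      (antitone_familyOfPointSet P hcard hC hN) (fun r t ht _ hle => ?_) (fun _ _ _ => trivial)
    exact exists_eq_of_isPyramid P hP hcard hC hN r t ⟨ht (by decide), ht (by decide)⟩ hle
  · exact twistedOrbitSum_familyWord_ne_zero_closed k pt (antitone_familyOfPointSet P hcard hC hN)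
      (familyOfPointSet_injective P hcard hC hN)

/-- **FI Thm. 4, `a̲_λ(n,3) ≤ a_λ(n,3)` in positivity form (open cone).** A pyramid in the open cone
`C` with `n` points, coordinates `< N`, gives a nonzero highest-weight vector of weight `S(P)` in the
`s`-isotypic (`Λⁿ Λ³`) part of `(k^N)^{⊗3n}`: FI's `w_P = ⋀_{(x,y,z) ∈ P} X_x ∧ X_y ∧ X_z`.
[cite: FischerIkenmeyer2020, Thm. 4 (lower bound) and its proof] -/
theorem exists_mem_wreathHW_of_isPyramid_open (P : Finset Point)
    (hP : IsPyramid IsInOpenCone P) (hcard : P.card = n) (hN : ∀ p ∈ P, p.1 < N) :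
    ∃ x ∈ wreathHW k N (restrSign n 3) (fun i => (sumMarginal P i : ℤ)), x ≠ 0 := by
  have hO : ∀ p ∈ P, IsInOpenCone p := hP.1
  have hC : ∀ p ∈ P, IsInClosedCone p := fun p hp => ⟨(hO p hp).1.le, (hO p hp).2.le⟩
  set pt := familyOfPointSet P hcard hC hN with hpt
  refine ⟨twistedOrbitSum k (restrSign n 3) (Pi.single (familyWord pt) 1), ?_, ?_⟩
  · rw [weight_sumMarginal_eq P hcard hC hN]
    refine twistedOrbitSum_familyWord_mem_wreathHW k (Or.inl rfl) pt (fun t => t 1 < t 0 ∧ t 2 < t 1)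
      (antitone_familyOfPointSet P hcard hC hN) (fun r t _ hgood hle => ?_) (fun u hno r => ?_)
    · exact exists_eq_of_isPyramid P hP hcard hC hN r t hgood hle
    · have hinj := blockTriple_injective_of_noOdd_restrSign hno r
      have h := isInOpenCone_sortPt hinj
      simpa [IsInOpenCone, sortPt] using h
  · exact twistedOrbitSum_familyWord_ne_zero_open k pt (antitone_familyOfPointSet P hcard hC hN)
      (familyOfPointSet_injective P hcard hC hN)
      (fun r => familyOfPointSet_injective_of_open P hcard hO hC hN r)

end Lower

end Literature.RepresentationTheory.GeneralLinear
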